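import Literature.Analysis.FluidPDE.OseenDuhamelPairCalculus
import Mathlib.MeasureTheory.Integral.DominatedConvergence
import HarnessLib

/-!
# The Oseen–Duhamel bilinear term under TIME-DEPENDENT envelopes: integrability, bilinearity,
  splitting of the time integral, and dominated convergence in the slots

Analysis/FluidPDE support file (everything proved) for the linear step, in forcing form, of the
perturbation theorem of M. P. Coiculescu, S. Palasek, *Non-uniqueness of smooth solutions of the
Navier–Stokes equations from critical data*, Invent. Math. 244 (2025) = arXiv:2503.14699,
Props. 4.2–4.3 with App. B (hypothesis `hB` of
`Literature.Barriers.NavierStokesRegularity.CriticalDataSmoothNonuniqueness_of_principalParts_of_perturbationThreshold`).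
The fields of that problem are singular at the initial time — the principal part obeys
`‖v(τ)‖_∞ ≲ τ^{-1/2}` (Prop. 3.13), the correction `‖w(τ)‖_∞ ≲ τ^{-1/2+α}`, the residual
`‖F(τ)‖_∞ ≲ τ^{-1+α}` (Prop. 4.1) — so the window calculus of `OseenDuhamelPairCalculus.lean`
(constant bounds) is extended here to SLICE-WISE bounds `‖a τ y‖ ≤ M_a(τ)`, `‖b τ y‖ ≤ M_b(τ)` with
an integrable envelope `(t-τ)^{-1/2} M_a(τ) M_b(τ)` on `(t₀, t)`:

* `integrableOn_oseenSlice_of_envelope` — integrability of `τ ↦ N_{t-τ}[a τ, b τ](x)`;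
* `oseenDuhamel_add_left/right_of_envelope`, `oseenDuhamel_sub_left/right_of_envelope` —
  bilinearity of `B_{t₀}` in each slot;
* `oseenDuhamel_sub_oseenDuhamel_eq_setIntegral` — moving the initial time:
  `B_s(a,b)(t) - B_{s'}(a,b)(t) = ∫_{(s,t) ∩ (-∞,s']} N_{t-τ}[a τ, b τ] dτ` for `s ≤ s'`, with the
  bound `norm_oseenDuhamel_sub_oseenDuhamel_le` by the Abel transform of the envelope over the
  layer `(s, s' ∧ t)` (the free term of one dyadic layer of forcing);
* `tendsto_oseenDuhamel_of_dominated` — dominated convergence in BOTH slots: if `a_n → a`,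
  `b_n → b` pointwise under common envelopes, then `B_{t₀}(a_n, b_n)(t)(x) → B_{t₀}(a, b)(t)(x)`
  (twice `tendsto_integral_of_dominated_convergence`: in `y` under the parabolic envelope of the
  kernel, in `τ` under `C₀(t-τ)^{-1/2}M_a M_b`).

## Mathlib / tree search

Tree: `oseenSlice`, `oseenKernelCLM`, `exists_norm_oseenKernel_le`,
`integrable_add_norm_sq_rpow_neg_half_succ`, `integral_add_norm_sq_rpow_neg_half_succ`,
`norm_oseenKernel_apply_le_weight`, `stronglyMeasurable_oseenSlice_duhamel` (`OseenSlice.lean`);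
`oseenSliceConst`, `norm_oseenSlice_le_oseenSliceConst`, `oseenDuhamel_one_eq_setIntegral_oseenSlice`,
`norm_oseenDuhamel_le_setIntegral` (`OseenDuhamelPairCalculus.lean`). Mathlib:
`MeasureTheory.tendsto_integral_of_dominated_convergence`, `MeasureTheory.setIntegral_union`.

## References

* M. P. Coiculescu, S. Palasek, Invent. Math. 244 (2025) = arXiv:2503.14699: Prop. 3.13,
  Prop. 4.1, proof of Prop. 4.2, App. B Prop. B.1. [`CoiculescuPalasek2025`]
* G. Koch, N. Nadirashvili, G. Seregin, V. Šverák, Acta Math. 203 (2009) = arXiv:0709.3599,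
  §4 p. 8. [`KochNadirashviliSereginSverak2009`]
-/

noncomputable section

open MeasureTheory Set Function Filter
open _root_.Topology
open scoped ENNReal

namespace Literature.Analysis.FluidPDE

variable {E : Type*} [NormedAddCommGroup E] [InnerProductSpace ℝ E] [FiniteDimensional ℝ E]
  [MeasurableSpace E] [BorelSpace E]

/-! ### Integrability of the window integrand under an envelope -/

/-- Measurability of the window integrand `τ ↦ N_{t-τ}[a τ, b τ](x)`. [folklore] -/
theorem aestronglyMeasurable_oseenSlice_window {a b : ℝ → E → E} (ham : Measurable (uncurry a))
    (hbm : Measurable (uncurry b)) (t : ℝ) (x : E) {s : Set ℝ} :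
    AEStronglyMeasurable (fun τ => oseenSlice (t - τ) (a τ) (b τ) x) (volume.restrict s) := by
  have h := stronglyMeasurable_oseenSlice_duhamel 1 t ham hbm
  have h' : StronglyMeasurable (fun τ : ℝ => oseenSlice (1 * (t - τ)) (a τ) (b τ) x) :=
    h.comp_measurable (measurable_id.prodMk measurable_const)
  simp only [one_mul] at h'
  exact h'.aestronglyMeasurable.restrict

/-- **Integrability of the window integrand under an envelope**: jointly measurable fields with
`‖a τ y‖ ≤ M_a(τ)`, `‖b τ y‖ ≤ M_b(τ)` on `(t₀, t)` and `(t-τ)^{-1/2} M_a(τ) M_b(τ)` integrable on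
`(t₀, t)` give `τ ↦ N_{t-τ}[a τ, b τ](x)` integrable on `(t₀, t)`. [folklore] -/
theorem integrableOn_oseenSlice_of_envelope {t₀ t : ℝ} {a b : ℝ → E → E} {Ma Mb : ℝ → ℝ}
    (ham : Measurable (uncurry a)) (hbm : Measurable (uncurry b))
    (ha : ∀ τ ∈ Ioo t₀ t, ∀ y, ‖a τ y‖ ≤ Ma τ) (hb : ∀ τ ∈ Ioo t₀ t, ∀ y, ‖b τ y‖ ≤ Mb τ)
    (henv : IntegrableOn (fun τ => (t - τ) ^ (-(1 / 2 : ℝ)) * (Ma τ * Mb τ)) (Ioo t₀ t)) (x : E) :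
    IntegrableOn (fun τ => oseenSlice (t - τ) (a τ) (b τ) x) (Ioo t₀ t) := by
  refine Integrable.mono' (henv.const_mul (oseenSliceConst E))
    (aestronglyMeasurable_oseenSlice_window ham hbm t x) ?_
  filter_upwards [ae_restrict_mem measurableSet_Ioo] with τ hτ
  calc ‖oseenSlice (t - τ) (a τ) (b τ) x‖
      ≤ oseenSliceConst E * (t - τ) ^ (-(1 / 2 : ℝ)) * Ma τ * Mb τ :=
        norm_oseenSlice_le_oseenSliceConst (sub_pos.2 hτ.2) (ha τ hτ) (hb τ hτ) x
    _ = oseenSliceConst E * ((t - τ) ^ (-(1 / 2 : ℝ)) * (Ma τ * Mb τ)) := by ring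

/-- Integrability of each slice integrand under slice-wise bounds. [folklore] -/
theorem integrable_oseenKernel_slice_of_envelope {t₀ t : ℝ} {a b : ℝ → E → E} {Ma Mb : ℝ → ℝ}
    (ham : Measurable (uncurry a)) (hbm : Measurable (uncurry b))
    (ha : ∀ τ ∈ Ioo t₀ t, ∀ y, ‖a τ y‖ ≤ Ma τ) (hb : ∀ τ ∈ Ioo t₀ t, ∀ y, ‖b τ y‖ ≤ Mb τ)
    {τ : ℝ} (hτ : τ ∈ Ioo t₀ t) (x : E) :
    Integrable (fun y => oseenKernel (t - τ) (x - y) (a τ y) (b τ y)) volume :=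
  integrable_oseenKernel_slice_of_bound (sub_pos.2 hτ.2) ham.of_uncurry_left.aestronglyMeasurable
    hbm.of_uncurry_left.aestronglyMeasurable (ha τ hτ) (hb τ hτ) x

/-! ### Bilinearity under envelopes -/

section Bilinear

variable {t₀ t : ℝ} {a a' b b' : ℝ → E → E} {Ma Ma' Mb Mb' : ℝ → ℝ}

/-- **Additivity in the left slot** under envelopes. [folklore] -/
theorem oseenDuhamel_add_left_of_envelope (ham : Measurable (uncurry a))
    (ha'm : Measurable (uncurry a')) (hbm : Measurable (uncurry b))
    (ha : ∀ τ ∈ Ioo t₀ t, ∀ y, ‖a τ y‖ ≤ Ma τ) (ha' : ∀ τ ∈ Ioo t₀ t, ∀ y, ‖a' τ y‖ ≤ Ma' τ)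
    (hb : ∀ τ ∈ Ioo t₀ t, ∀ y, ‖b τ y‖ ≤ Mb τ)
    (henv : IntegrableOn (fun τ => (t - τ) ^ (-(1 / 2 : ℝ)) * (Ma τ * Mb τ)) (Ioo t₀ t))
    (henv' : IntegrableOn (fun τ => (t - τ) ^ (-(1 / 2 : ℝ)) * (Ma' τ * Mb τ)) (Ioo t₀ t)) (x : E) :
    oseenDuhamel 1 t₀ (a + a') b t x = oseenDuhamel 1 t₀ a b t x + oseenDuhamel 1 t₀ a' b t x := by
  rw [oseenDuhamel_one_eq_setIntegral_oseenSlice, oseenDuhamel_one_eq_setIntegral_oseenSlice,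
    oseenDuhamel_one_eq_setIntegral_oseenSlice,
    ← integral_add (integrableOn_oseenSlice_of_envelope ham hbm ha hb henv x)
      (integrableOn_oseenSlice_of_envelope ha'm hbm ha' hb henv' x)]
  refine setIntegral_congr_fun measurableSet_Ioo fun τ hτ => ?_
  exact oseenSlice_add_left (integrable_oseenKernel_slice_of_envelope ham hbm ha hb hτ x)
    (integrable_oseenKernel_slice_of_envelope ha'm hbm ha' hb hτ x)

/-- **Additivity in the right slot** under envelopes. [folklore] -/
theorem oseenDuhamel_add_right_of_envelope (ham : Measurable (uncurry a))
    (hbm : Measurable (uncurry b)) (hb'm : Measurable (uncurry b'))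
    (ha : ∀ τ ∈ Ioo t₀ t, ∀ y, ‖a τ y‖ ≤ Ma τ) (hb : ∀ τ ∈ Ioo t₀ t, ∀ y, ‖b τ y‖ ≤ Mb τ)
    (hb' : ∀ τ ∈ Ioo t₀ t, ∀ y, ‖b' τ y‖ ≤ Mb' τ)
    (henv : IntegrableOn (fun τ => (t - τ) ^ (-(1 / 2 : ℝ)) * (Ma τ * Mb τ)) (Ioo t₀ t))
    (henv' : IntegrableOn (fun τ => (t - τ) ^ (-(1 / 2 : ℝ)) * (Ma τ * Mb' τ)) (Ioo t₀ t)) (x : E) :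
    oseenDuhamel 1 t₀ a (b + b') t x = oseenDuhamel 1 t₀ a b t x + oseenDuhamel 1 t₀ a b' t x := by
  rw [oseenDuhamel_one_eq_setIntegral_oseenSlice, oseenDuhamel_one_eq_setIntegral_oseenSlice,
    oseenDuhamel_one_eq_setIntegral_oseenSlice,
    ← integral_add (integrableOn_oseenSlice_of_envelope ham hbm ha hb henv x)
      (integrableOn_oseenSlice_of_envelope ham hb'm ha hb' henv' x)]
  refine setIntegral_congr_fun measurableSet_Ioo fun τ hτ => ?_
  exact oseenSlice_add_right (integrable_oseenKernel_slice_of_envelope ham hbm ha hb hτ x)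
    (integrable_oseenKernel_slice_of_envelope ham hb'm ha hb' hτ x)

/-- **Subtraction in the left slot** under envelopes. [folklore] -/
theorem oseenDuhamel_sub_left_of_envelope (ham : Measurable (uncurry a))
    (ha'm : Measurable (uncurry a')) (hbm : Measurable (uncurry b))
    (ha : ∀ τ ∈ Ioo t₀ t, ∀ y, ‖a τ y‖ ≤ Ma τ) (ha' : ∀ τ ∈ Ioo t₀ t, ∀ y, ‖a' τ y‖ ≤ Ma' τ)
    (hb : ∀ τ ∈ Ioo t₀ t, ∀ y, ‖b τ y‖ ≤ Mb τ)
    (henv : IntegrableOn (fun τ => (t - τ) ^ (-(1 / 2 : ℝ)) * (Ma τ * Mb τ)) (Ioo t₀ t))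
    (henv' : IntegrableOn (fun τ => (t - τ) ^ (-(1 / 2 : ℝ)) * (Ma' τ * Mb τ)) (Ioo t₀ t)) (x : E) :
    oseenDuhamel 1 t₀ (a - a') b t x = oseenDuhamel 1 t₀ a b t x - oseenDuhamel 1 t₀ a' b t x := by
  rw [oseenDuhamel_one_eq_setIntegral_oseenSlice, oseenDuhamel_one_eq_setIntegral_oseenSlice,
    oseenDuhamel_one_eq_setIntegral_oseenSlice,
    ← integral_sub (integrableOn_oseenSlice_of_envelope ham hbm ha hb henv x)
      (integrableOn_oseenSlice_of_envelope ha'm hbm ha' hb henv' x)]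
  refine setIntegral_congr_fun measurableSet_Ioo fun τ hτ => ?_
  exact oseenSlice_sub_left (integrable_oseenKernel_slice_of_envelope ham hbm ha hb hτ x)
    (integrable_oseenKernel_slice_of_envelope ha'm hbm ha' hb hτ x)

/-- **Subtraction in the right slot** under envelopes. [folklore] -/
theorem oseenDuhamel_sub_right_of_envelope (ham : Measurable (uncurry a))
    (hbm : Measurable (uncurry b)) (hb'm : Measurable (uncurry b'))
    (ha : ∀ τ ∈ Ioo t₀ t, ∀ y, ‖a τ y‖ ≤ Ma τ) (hb : ∀ τ ∈ Ioo t₀ t, ∀ y, ‖b τ y‖ ≤ Mb τ)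
    (hb' : ∀ τ ∈ Ioo t₀ t, ∀ y, ‖b' τ y‖ ≤ Mb' τ)
    (henv : IntegrableOn (fun τ => (t - τ) ^ (-(1 / 2 : ℝ)) * (Ma τ * Mb τ)) (Ioo t₀ t))
    (henv' : IntegrableOn (fun τ => (t - τ) ^ (-(1 / 2 : ℝ)) * (Ma τ * Mb' τ)) (Ioo t₀ t)) (x : E) :
    oseenDuhamel 1 t₀ a (b - b') t x = oseenDuhamel 1 t₀ a b t x - oseenDuhamel 1 t₀ a b' t x := by
  rw [oseenDuhamel_one_eq_setIntegral_oseenSlice, oseenDuhamel_one_eq_setIntegral_oseenSlice,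
    oseenDuhamel_one_eq_setIntegral_oseenSlice,
    ← integral_sub (integrableOn_oseenSlice_of_envelope ham hbm ha hb henv x)
      (integrableOn_oseenSlice_of_envelope ham hb'm ha hb' henv' x)]
  refine setIntegral_congr_fun measurableSet_Ioo fun τ hτ => ?_
  exact oseenSlice_sub_right (integrable_oseenKernel_slice_of_envelope ham hbm ha hb hτ x)
    (integrable_oseenKernel_slice_of_envelope ham hb'm ha hb' hτ x)

end Bilinear

/-! ### Moving the initial time -/

/-- **Moving the initial time**: for `s ≤ s'` and an integrable window integrand on `(s, t)`,
`B_s(a,b)(t)(x) - B_{s'}(a,b)(t)(x) = ∫_{(s,t) ∩ (-∞, s']} N_{t-τ}[a τ, b τ](x) dτ` (additivity of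
the time integral: `(s,t) = ((s,t) ∩ (-∞,s']) ∪ (s',t)`). [folklore] -/
theorem oseenDuhamel_sub_oseenDuhamel_eq_setIntegral {s s' t : ℝ} (hss' : s ≤ s') {a b : ℝ → E → E}
    {x : E} (hint : IntegrableOn (fun τ => oseenSlice (t - τ) (a τ) (b τ) x) (Ioo s t)) :
    oseenDuhamel 1 s a b t x - oseenDuhamel 1 s' a b t x =
      ∫ τ in Ioo s t ∩ Iic s', oseenSlice (t - τ) (a τ) (b τ) x := by
  rw [oseenDuhamel_one_eq_setIntegral_oseenSlice, oseenDuhamel_one_eq_setIntegral_oseenSlice]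
  have hsplit : Ioo s t = (Ioo s t ∩ Iic s') ∪ Ioo s' t := by
    ext τ
    simp only [mem_union, mem_inter_iff, mem_Ioo, mem_Iic]
    constructor
    · intro h
      rcases le_or_gt τ s' with h1 | h1
      · exact Or.inl ⟨h, h1⟩
      · exact Or.inr ⟨h1, h.2⟩
    · rintro (⟨h, -⟩ | h)
      · exact h
      · exact ⟨hss'.trans_lt h.1, h.2⟩
  have hdisj : Disjoint (Ioo s t ∩ Iic s') (Ioo s' t) := by
    rw [Set.disjoint_left]
    rintro τ ⟨-, h1⟩ h2
    exact absurd h2.1 (not_lt.2 h1)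
  have hunion : ∫ τ in Ioo s t, oseenSlice (t - τ) (a τ) (b τ) x =
      (∫ τ in Ioo s t ∩ Iic s', oseenSlice (t - τ) (a τ) (b τ) x) +
        ∫ τ in Ioo s' t, oseenSlice (t - τ) (a τ) (b τ) x := by
    rw [← setIntegral_union hdisj measurableSet_Ioo (hint.mono_set inter_subset_left)
      (hint.mono_set (Ioo_subset_Ioo hss' le_rfl)), ← hsplit]
  rw [hunion]
  abel

/-- **Bound for the layer piece**: under slice-wise bounds with an envelope integrable on the
layer, `‖B_s(a,b)(t)(x) - B_{s'}(a,b)(t)(x)‖ ≤ C₀ ∫_{(s,t) ∩ (-∞,s']} (t-τ)^{-1/2} M_a(τ)M_b(τ) dτ`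
(`s ≤ s'`): the free term of the forcing layer `(s, s']` seen from time `t` — the quantity
bounded by `7 C₀ N s^α / √t` in `Literature.Analysis.ODE.sqrt_mul_setIntegral_layer_le` when
`M_a M_b ≤ N τ^{α-1}` on the dyadic layer `s' = 2s`. [cite: CoiculescuPalasek2025, proof of Prop. 4.2 (term I) and proof of Prop. 4.3] -/
theorem norm_oseenDuhamel_sub_oseenDuhamel_le {s s' t : ℝ} (hss' : s ≤ s') {a b : ℝ → E → E}
    {Ma Mb : ℝ → ℝ} (ham : Measurable (uncurry a)) (hbm : Measurable (uncurry b))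
    (ha : ∀ τ ∈ Ioo s t, ∀ y, ‖a τ y‖ ≤ Ma τ) (hb : ∀ τ ∈ Ioo s t, ∀ y, ‖b τ y‖ ≤ Mb τ)
    (henv : IntegrableOn (fun τ => (t - τ) ^ (-(1 / 2 : ℝ)) * (Ma τ * Mb τ)) (Ioo s t)) (x : E) :
    ‖oseenDuhamel 1 s a b t x - oseenDuhamel 1 s' a b t x‖ ≤
      oseenSliceConst E * ∫ τ in Ioo s t ∩ Iic s', (t - τ) ^ (-(1 / 2 : ℝ)) * (Ma τ * Mb τ) := by
  rw [oseenDuhamel_sub_oseenDuhamel_eq_setIntegral hss'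
    (integrableOn_oseenSlice_of_envelope ham hbm ha hb henv x)]
  have hI : IntegrableOn (fun τ => oseenSliceConst E * ((t - τ) ^ (-(1 / 2 : ℝ)) * (Ma τ * Mb τ)))
      (Ioo s t ∩ Iic s') := (henv.mono_set inter_subset_left).const_mul _
  have hS : MeasurableSet (Ioo s t ∩ Iic s') := measurableSet_Ioo.inter measurableSet_Iic
  have hbound : ∀ τ ∈ Ioo s t ∩ Iic s', ‖oseenSlice (t - τ) (a τ) (b τ) x‖ ≤
      oseenSliceConst E * ((t - τ) ^ (-(1 / 2 : ℝ)) * (Ma τ * Mb τ)) := by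
    intro τ hτ
    have hσ : 0 < t - τ := sub_pos.2 hτ.1.2
    calc ‖oseenSlice (t - τ) (a τ) (b τ) x‖
        ≤ oseenSliceConst E * (t - τ) ^ (-(1 / 2 : ℝ)) * Ma τ * Mb τ :=
          norm_oseenSlice_le_oseenSliceConst hσ (ha τ hτ.1) (hb τ hτ.1) x
      _ = oseenSliceConst E * ((t - τ) ^ (-(1 / 2 : ℝ)) * (Ma τ * Mb τ)) := by ring
  calc ‖∫ τ in Ioo s t ∩ Iic s', oseenSlice (t - τ) (a τ) (b τ) x‖
      ≤ ∫ τ in Ioo s t ∩ Iic s', oseenSliceConst E * ((t - τ) ^ (-(1 / 2 : ℝ)) * (Ma τ * Mb τ)) :=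
        norm_integral_le_of_norm_le hI (ae_restrict_of_forall_mem hS hbound)
    _ = oseenSliceConst E * ∫ τ in Ioo s t ∩ Iic s', (t - τ) ^ (-(1 / 2 : ℝ)) * (Ma τ * Mb τ) :=
        integral_const_mul _ _

/-- Two sets of reals that differ by at most one point are a.e. equal for Lebesgue measure.
[folklore] -/
theorem ae_eq_of_subset_of_subset_union_singleton {A B : Set ℝ} {p : ℝ} (h1 : A ⊆ B)
    (h2 : B ⊆ A ∪ {p}) : A =ᵐ[volume] B := by
  have hAB : B \ A ⊆ {p} := fun τ hτ => by
    rcases h2 hτ.1 with h | h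
    · exact absurd h hτ.2
    · exact h
  refine (ae_eq_set).2 ⟨?_, ?_⟩
  · exact measure_mono_null (fun τ hτ => (hτ.2 (h1 hτ.1)).elim) measure_empty
  · exact measure_mono_null hAB (measure_singleton p)

/-- The layer domain up to a null set: `(s,t) ∩ (-∞, s']` and `(s, t ∧ s')` differ at most by the
point `s'`, so the set integrals over them agree. [folklore] -/
theorem setIntegral_inter_Iic_eq_setIntegral_Ioo_min {s s' t : ℝ} (f : ℝ → ℝ) :
    ∫ τ in Ioo s t ∩ Iic s', f τ = ∫ τ in Ioo s (min t s'), f τ := by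
  refine setIntegral_congr_set (ae_eq_of_subset_of_subset_union_singleton (p := s') ?_ ?_).symm
  · exact fun τ hτ =>
      ⟨⟨hτ.1, hτ.2.trans_le (min_le_left _ _)⟩, (hτ.2.trans_le (min_le_right _ _)).le⟩
  · rintro τ ⟨hτ, hτ'⟩
    rcases (show τ ≤ s' from hτ').lt_or_eq with h | h
    · exact Or.inl ⟨hτ.1, lt_min hτ.2 h⟩
    · exact Or.inr h

/-! ### Dominated convergence in the slots -/

/-- **Dominated convergence in both slots of the bilinear term.** Let `aₙ → a`, `bₙ → b`
pointwise on `(t₀, t) × E`, the `aₙ, bₙ` jointly measurable with common slice-wise bounds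
`‖aₙ τ y‖ ≤ M_a(τ)` and `‖bₙ τ y‖ ≤ M_b(τ)` on `(t₀, t)` (the limits then obey the same) and an integrable
envelope `(t-τ)^{-1/2} M_a(τ) M_b(τ)`. Then `B_{t₀}(aₙ, bₙ)(t)(x) → B_{t₀}(a, b)(t)(x)`: dominated
convergence in `y` (the kernel is a continuous bilinear map of its tensor slots, dominated by the
parabolic envelope) and then in `τ` (dominated by `C₀(t-τ)^{-1/2}M_a M_b`). This passes the
linearised equation to the limit along the dyadic exhaustion of `(0, T]`. [folklore] -/
theorem tendsto_oseenDuhamel_of_dominated {t₀ t : ℝ} {a b : ℕ → ℝ → E → E} {aL bL : ℝ → E → E}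
    {Ma Mb : ℝ → ℝ} (ham : ∀ n, Measurable (uncurry (a n))) (hbm : ∀ n, Measurable (uncurry (b n)))
    (ha : ∀ n, ∀ τ ∈ Ioo t₀ t, ∀ y, ‖a n τ y‖ ≤ Ma τ) (hb : ∀ n, ∀ τ ∈ Ioo t₀ t, ∀ y, ‖b n τ y‖ ≤ Mb τ)
    (henv : IntegrableOn (fun τ => (t - τ) ^ (-(1 / 2 : ℝ)) * (Ma τ * Mb τ)) (Ioo t₀ t))
    (hlim_a : ∀ τ ∈ Ioo t₀ t, ∀ y, Tendsto (fun n => a n τ y) atTop (𝓝 (aL τ y)))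
    (hlim_b : ∀ τ ∈ Ioo t₀ t, ∀ y, Tendsto (fun n => b n τ y) atTop (𝓝 (bL τ y))) (x : E) :
    Tendsto (fun n => oseenDuhamel 1 t₀ (a n) (b n) t x) atTop (𝓝 (oseenDuhamel 1 t₀ aL bL t x)) := by
  simp only [oseenDuhamel_one_eq_setIntegral_oseenSlice]
  -- slice convergence by dominated convergence in `y`
  have hslice : ∀ τ ∈ Ioo t₀ t, Tendsto (fun n => oseenSlice (t - τ) (a n τ) (b n τ) x) atTop
      (𝓝 (oseenSlice (t - τ) (aL τ) (bL τ) x)) := by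
    intro τ hτ
    have hσ : 0 < t - τ := sub_pos.2 hτ.2
    obtain ⟨C, hC, hK⟩ := exists_norm_oseenKernel_le (E := E)
    simp only [oseenSlice_apply]
    refine tendsto_integral_of_dominated_convergence
      (fun y => C * Ma τ * Mb τ * ((t - τ) + ‖x - y‖ ^ 2) ^ (-(((Module.finrank ℝ E : ℝ) + 1) / 2)))
      (fun n => ?_) ?_ (fun n => Eventually.of_forall fun y => ?_) (Eventually.of_forall fun y => ?_)
    · exact (integrable_oseenKernel_slice_of_envelope (ham n) (hbm n) (ha n) (hb n) hτ x).aestronglyMeasurable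
    · exact ((integrable_add_norm_sq_rpow_neg_half_succ (E := E) hσ).comp_sub_left x).const_mul _
    · exact norm_oseenKernel_apply_le_weight hK hC.le hσ (ha n τ hτ) (hb n τ hτ) x y
    · have hc : Continuous fun p : E × E => oseenKernel (t - τ) (x - y) p.1 p.2 := by
        have h2 := (oseenKernelCLM (t - τ) (x - y)).continuous₂
        simp only [oseenKernelCLM_apply] at h2
        exact h2
      have hp : Tendsto (fun n => (a n τ y, b n τ y)) atTop (𝓝 (aL τ y, bL τ y)) :=
        (hlim_a τ hτ y).prodMk_nhds (hlim_b τ hτ y)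
      exact (hc.tendsto _).comp hp
  -- then dominated convergence in `τ`
  refine tendsto_integral_of_dominated_convergence
    (fun τ => oseenSliceConst E * ((t - τ) ^ (-(1 / 2 : ℝ)) * (Ma τ * Mb τ)))
    (fun n => aestronglyMeasurable_oseenSlice_window (ham n) (hbm n) t x) (henv.const_mul _)
    (fun n => ?_) ?_
  · filter_upwards [ae_restrict_mem measurableSet_Ioo] with τ hτ
    calc ‖oseenSlice (t - τ) (a n τ) (b n τ) x‖
        ≤ oseenSliceConst E * (t - τ) ^ (-(1 / 2 : ℝ)) * Ma τ * Mb τ :=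
          norm_oseenSlice_le_oseenSliceConst (sub_pos.2 hτ.2) (ha n τ hτ) (hb n τ hτ) x
      _ = oseenSliceConst E * ((t - τ) ^ (-(1 / 2 : ℝ)) * (Ma τ * Mb τ)) := by ring
  · filter_upwards [ae_restrict_mem measurableSet_Ioo] with τ hτ
    exact hslice τ hτ

end Literature.Analysis.FluidPDE
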